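import Mathlib.Analysis.SpecialFunctions.Trigonometric.InverseDeriv
import Mathlib.Analysis.SpecialFunctions.Sqrt
import Mathlib.Analysis.Calculus.SmoothSeries
import Mathlib.Analysis.Calculus.MeanValue
import Mathlib.Analysis.SpecificLimits.Normed
import Mathlib.Analysis.PSeries
import Mathlib.Data.Nat.Choose.Central
import HarnessLib

/-!
# The power series of the even powers of `arcsin` (Borwein–Chamberland)

For every `a ≥ 0` and `|x| < 1`,

`(2 arcsin x)^{2a+2} / (2a+2)! = ∑_{n ≥ 1} 4ⁿ e_a(n) / (n² binom(2n,n)) · x^{2n}`,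
`e_a(n) = ∑_{n > n₁ > ⋯ > n_a ≥ 1} (n₁ ⋯ n_a)^{-2}`

(J. M. Borwein, M. Chamberland, *Integer powers of arcsin*, IJMMS 2007; the case `a = 0` is Euler's
`arcsin² x = ½ ∑ (2x)^{2n} / (n² binom(2n,n))`). This is formula (2)/(6) of Lai–Lupu–Orr
[LaiLupuOrr2026, §3], the first ingredient of their elementary proof of Zagier's evaluation of
`ζ(2,…,2,3,2,…,2)` (Zagier 2012, Theorem 1 = Brown 2012, Theorem 4.1), for which this file was
written (see `Literature.NumberTheory.Transcendental.BrownZagierFormulaProofs`).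

## Contents (all proved)

* `arcsinNestedSum a n = e_a(n)` (recursive: `e₀ = 1`, `e_{a+1}(n) = ∑_{1 ≤ m < n} m^{-2} e_a(m)`),
  `arcsinCoeff a n = c_a(n) = 4ⁿ e_a(n) / (n² binom(2n,n))` (`c_a(0) = 0`), bounds
  `0 ≤ e_a(n) ≤ 2^a`, `0 ≤ c_a(n) ≤ 2^{a+1}`;
* the coefficient recursion `c_a(n+1)(2n+2)(2n+1) − 4n² c_a(n) = 4 c_{a-1}(n)` (`arcsinCoeff_rec`;
  for `a = 0` the right-hand side is `4·[n = 0]`), from `(n+1) binom(2n+2,n+1) = 2(2n+1) binom(2n,n)`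
  and `e_a(n+1) − e_a(n) = e_{a-1}(n)/n²`;
* `hasSum_arcsinCoeff` : **the theorem**, `HasSum (fun n ↦ c_a(n) x^{2n}) ((2 arcsin x)^{2a+2}/(2a+2)!)`
  for `|x| < 1`.

## Proof

Not the hypergeometric proof of Borwein–Chamberland (`cos(λ arcsin x) = ₂F₁(λ/2,−λ/2;½;x²)`) but
the equivalent ODE argument: `y_k = (2 arcsin x)^{2k}/(2k)!` satisfies
`(1 − x²) y_{k+1}'' − x y_{k+1}' = 4 y_k`, `y_{k+1}(0) = y_{k+1}'(0) = 0`; the series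
`S_a = ∑ c_a(n) x^{2n}` satisfies the same equation with `S_{a-1}` (resp. `4`) on the right by the
coefficient recursion (termwise differentiation, `hasDerivAt_tsum_of_isPreconnected`); and a solution
`D` of `(1 − x²) D'' − x D' = 0` on `(−1,1)` with `D(0) = D'(0) = 0` vanishes, because
`W = √(1−x²) D'` has `W' = 0` (`IsOpen.is_const_of_deriv_eq_zero`). Induction on `a`.

Mathlib has `Real.arcsin` with its derivative but no power series for `arcsin` or its powers
(searched: `arcsin`, `hasSum`, `FormalMultilinearSeries` under `SpecialFunctions/Trigonometric`).

## References

* [BorweinChamberland2007] J. M. Borwein, M. Chamberland, *Integer powers of arcsin*, Int. J. Math.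
  Math. Sci. (2007), Art. ID 19381.
* [LaiLupuOrr2026] L. Lai, C. Lupu, D. Orr, *Elementary proofs of Zagier's formula for multiple zeta
  values and its odd variant*, Proc. AMS 154 (2026), 11–24 (arXiv:2201.09262), §3, eq. (2), (6).
-/

noncomputable section

open Filter Set Real
open scoped Topology BigOperators Nat

namespace Literature.Analysis.SpecialFunctions

/-! ### The nested sums `e_a(n)` and the coefficients `c_a(n)` -/

/-- The nested harmonic sums `e_a(n) = ∑_{n > n₁ > ⋯ > n_a ≥ 1} n₁^{-2} ⋯ n_a^{-2}` (the elementary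
symmetric functions of `1, 1/2², …, 1/(n-1)²`), defined by the recursion `e₀(n) = 1`,
`e_{a+1}(n) = ∑_{1 ≤ m < n} m^{-2} e_a(m)`; they are the truncated multiple zeta sums `Z_n(2,…,2)`.
[cite: LaiLupuOrr2026, §3 eq. (2)] -/
def arcsinNestedSum : ℕ → ℕ → ℝ
  | 0, _ => 1
  | a + 1, n => ∑ m ∈ Finset.Ico 1 n, ((m : ℝ) ^ 2)⁻¹ * arcsinNestedSum a m

/-- `e₀(n) = 1`. [folklore] -/
@[simp] theorem arcsinNestedSum_zero (n : ℕ) : arcsinNestedSum 0 n = 1 := by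
  simp [arcsinNestedSum]

/-- The recursion `e_{a+1}(n) = ∑_{1 ≤ m < n} m^{-2} e_a(m)`. [folklore] -/
theorem arcsinNestedSum_succ (a n : ℕ) :
    arcsinNestedSum (a + 1) n = ∑ m ∈ Finset.Ico 1 n, ((m : ℝ) ^ 2)⁻¹ * arcsinNestedSum a m := by
  rw [arcsinNestedSum]

/-- `e_a(n) ≥ 0`. [folklore] -/
theorem arcsinNestedSum_nonneg : ∀ a n, 0 ≤ arcsinNestedSum a n
  | 0, n => by simp
  | a + 1, n => by
      rw [arcsinNestedSum_succ]
      exact Finset.sum_nonneg fun m _ =>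
        mul_nonneg (inv_nonneg.2 (sq_nonneg _)) (arcsinNestedSum_nonneg a m)

/-- The crude bound `e_a(n) ≤ 2^a` (from `∑_{1 ≤ m < n} 1/m² ≤ 2`, Mathlib's `sum_Ioo_inv_sq_le`;
cf. `MZV.sum_Ico_inv_sq_le_two` in the multiple-zeta files, not imported here). [folklore] -/
theorem arcsinNestedSum_le : ∀ a n, arcsinNestedSum a n ≤ 2 ^ a
  | 0, n => by simp
  | a + 1, n => by
      have sum_Ico_one_inv_sq_le_two : ∑ m ∈ Finset.Ico 1 n, ((m : ℝ) ^ 2)⁻¹ ≤ 2 := by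
        rcases Nat.lt_or_ge n 2 with hn | hn
        · interval_cases n <;> simp
        · have h : Finset.Ico 1 n = insert 1 (Finset.Ioo 1 n) := by
            ext m; simp only [Finset.mem_Ico, Finset.mem_insert, Finset.mem_Ioo]; omega
          rw [h, Finset.sum_insert (by simp)]
          have h2 := sum_Ioo_inv_sq_le (α := ℝ) 1 n
          norm_num at h2 ⊢
          linarith
      rw [arcsinNestedSum_succ, pow_succ]
      calc ∑ m ∈ Finset.Ico 1 n, ((m : ℝ) ^ 2)⁻¹ * arcsinNestedSum a m
          ≤ ∑ m ∈ Finset.Ico 1 n, ((m : ℝ) ^ 2)⁻¹ * 2 ^ a :=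
            Finset.sum_le_sum fun m _ =>
              mul_le_mul_of_nonneg_left (arcsinNestedSum_le a m) (inv_nonneg.2 (sq_nonneg _))
        _ = (∑ m ∈ Finset.Ico 1 n, ((m : ℝ) ^ 2)⁻¹) * 2 ^ a := (Finset.sum_mul _ _ _).symm
        _ ≤ 2 * 2 ^ a :=
            mul_le_mul_of_nonneg_right sum_Ico_one_inv_sq_le_two (by positivity)
        _ = 2 ^ a * 2 := mul_comm _ _

/-- The recursion in `n`: `e_{a+1}(n+1) = e_{a+1}(n) + n^{-2} e_a(n)` (`n ≥ 1`). [folklore] -/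
theorem arcsinNestedSum_succ_succ (a : ℕ) {n : ℕ} (hn : 1 ≤ n) :
    arcsinNestedSum (a + 1) (n + 1) =
      arcsinNestedSum (a + 1) n + ((n : ℝ) ^ 2)⁻¹ * arcsinNestedSum a n := by
  rw [arcsinNestedSum_succ, arcsinNestedSum_succ, Finset.sum_Ico_succ_top hn]

/-- `e_{a+1}(1) = 0` (an empty nested sum). [folklore] -/
@[simp] theorem arcsinNestedSum_succ_one (a : ℕ) : arcsinNestedSum (a + 1) 1 = 0 := by
  rw [arcsinNestedSum_succ]; simp

/-- `e_{a+1}(0) = 0`. [folklore] -/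
@[simp] theorem arcsinNestedSum_succ_zero (a : ℕ) : arcsinNestedSum (a + 1) 0 = 0 := by
  rw [arcsinNestedSum_succ]; simp

/-- The Taylor coefficients `c_a(n) = 4ⁿ e_a(n) / (n² binom(2n,n))` of `(2 arcsin x)^{2a+2}/(2a+2)!`
(so `c_a(0) = 0` — in Lean by the junk value `x / 0 = 0`, mathematically because the series has
no constant term). [cite: LaiLupuOrr2026, §3 eq. (6)] -/
def arcsinCoeff (a n : ℕ) : ℝ :=
  4 ^ n * arcsinNestedSum a n / ((n : ℝ) ^ 2 * (n.centralBinom : ℝ))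

/-- `c_a(0) = 0`. [folklore] -/
@[simp] theorem arcsinCoeff_zero_right (a : ℕ) : arcsinCoeff a 0 = 0 := by simp [arcsinCoeff]

/-- `c_a(n) ≥ 0`. [folklore] -/
theorem arcsinCoeff_nonneg (a n : ℕ) : 0 ≤ arcsinCoeff a n :=
  div_nonneg (mul_nonneg (by positivity) (arcsinNestedSum_nonneg a n)) (by positivity)

/-- The crude bound `c_a(n) ≤ 2^{a+1}` (from `4ⁿ ≤ 2n binom(2n,n)` and `e_a(n) ≤ 2^a`). [folklore] -/
theorem arcsinCoeff_le (a n : ℕ) : arcsinCoeff a n ≤ 2 ^ (a + 1) := by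
  rcases Nat.eq_zero_or_pos n with rfl | hn
  · rw [arcsinCoeff_zero_right]; positivity
  · unfold arcsinCoeff
    have hC : (0 : ℝ) < n.centralBinom := by exact_mod_cast Nat.centralBinom_pos n
    have h4 : (4 : ℝ) ^ n ≤ 2 * n * n.centralBinom := by
      exact_mod_cast Nat.four_pow_le_two_mul_self_mul_centralBinom n hn
    have hn' : (1 : ℝ) ≤ n := by exact_mod_cast hn
    rw [div_le_iff₀ (by positivity)]
    calc (4 : ℝ) ^ n * arcsinNestedSum a n ≤ (2 * n * n.centralBinom) * 2 ^ a :=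
          mul_le_mul h4 (arcsinNestedSum_le a n) (arcsinNestedSum_nonneg a n) (by positivity)
      _ = 2 ^ (a + 1) * ((n : ℝ) * n.centralBinom) := by ring
      _ ≤ 2 ^ (a + 1) * ((n : ℝ) ^ 2 * n.centralBinom) := by
          refine mul_le_mul_of_nonneg_left ?_ (by positivity)
          exact mul_le_mul_of_nonneg_right (by nlinarith) hC.le

/-- `|c_a(n)| ≤ 2^{a+1}`. [folklore] -/
theorem abs_arcsinCoeff_le (a n : ℕ) : |arcsinCoeff a n| ≤ 2 ^ (a + 1) := by
  rw [abs_of_nonneg (arcsinCoeff_nonneg a n)]; exact arcsinCoeff_le a n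

/-- `(n+1) binom(2n+2,n+1) = 2(2n+1) binom(2n,n)` in `ℝ` (Mathlib's `Nat.succ_mul_centralBinom_succ`).
[folklore] -/
theorem cast_succ_mul_centralBinom_succ (n : ℕ) :
    ((n : ℝ) + 1) * ((n + 1).centralBinom : ℝ) = 2 * (2 * n + 1) * (n.centralBinom : ℝ) := by
  exact_mod_cast Nat.succ_mul_centralBinom_succ n

/-- `c_a(n+1) (2n+2)(2n+1) = 4^{n+1} e_a(n+1) / binom(2n,n)`. [folklore] -/
theorem arcsinCoeff_succ_mul (a n : ℕ) :
    arcsinCoeff a (n + 1) * ((2 * n + 2) * (2 * n + 1)) =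
      4 ^ (n + 1) * arcsinNestedSum a (n + 1) / n.centralBinom := by
  unfold arcsinCoeff
  have hC : (n.centralBinom : ℝ) ≠ 0 := by exact_mod_cast Nat.centralBinom_ne_zero n
  have hC1 : ((n + 1).centralBinom : ℝ) ≠ 0 := by exact_mod_cast Nat.centralBinom_ne_zero (n + 1)
  have hn1 : ((n : ℝ) + 1) ≠ 0 := by positivity
  have h2n1 : (2 * (n : ℝ) + 1) ≠ 0 := by positivity
  have h := cast_succ_mul_centralBinom_succ n
  have key : ((n : ℝ) + 1) ^ 2 * ((n + 1).centralBinom : ℝ) =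
      ((n : ℝ) + 1) * (2 * (2 * n + 1)) * n.centralBinom := by
    rw [sq, mul_assoc, h]; ring
  push_cast
  rw [key]
  field_simp

/-- `4 n² c_a(n) = 4^{n+1} e_a(n) / binom(2n,n)` (`n ≥ 1`). [folklore] -/
theorem four_mul_sq_mul_arcsinCoeff (a : ℕ) {n : ℕ} (hn : n ≠ 0) :
    4 * (n : ℝ) ^ 2 * arcsinCoeff a n = 4 ^ (n + 1) * arcsinNestedSum a n / n.centralBinom := by
  unfold arcsinCoeff
  have hC : (n.centralBinom : ℝ) ≠ 0 := by exact_mod_cast Nat.centralBinom_ne_zero n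
  have hn' : (n : ℝ) ≠ 0 := by exact_mod_cast hn
  field_simp
  ring

/-- The right-hand side of the coefficient recursion: `c_{a-1}(n)` for `a ≥ 1`, and the
Kronecker delta `[n = 0]` for `a = 0` (the constant `4` in `(1-x²)y'' - xy' = 4` for
`y = (2 arcsin x)²/2`). [folklore] -/
def arcsinCoeffLower : ℕ → ℕ → ℝ
  | 0, n => if n = 0 then 1 else 0
  | a + 1, n => arcsinCoeff a n

/-- `arcsinCoeffLower (a+1) n = c_a(n)`. [folklore] -/
@[simp] theorem arcsinCoeffLower_succ (a n : ℕ) : arcsinCoeffLower (a + 1) n = arcsinCoeff a n := rfl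

/-- `arcsinCoeffLower 0 n = [n = 0]`. [folklore] -/
theorem arcsinCoeffLower_zero (n : ℕ) : arcsinCoeffLower 0 n = if n = 0 then 1 else 0 := rfl

/-- `0 ≤ arcsinCoeffLower a n ≤ 2^a`. [folklore] -/
theorem abs_arcsinCoeffLower_le (a n : ℕ) : |arcsinCoeffLower a n| ≤ 2 ^ a := by
  cases a with
  | zero => rw [arcsinCoeffLower_zero]; split_ifs <;> simp
  | succ a => rw [arcsinCoeffLower_succ]; exact abs_arcsinCoeff_le a n

/-- **The coefficient recursion** `c_a(n+1)(2n+2)(2n+1) − 4n² c_a(n) = 4 c_{a-1}(n)` (with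
`c_{-1}(n) := [n = 0]`), i.e. the ODE `(1 - x²) y'' - x y' = 4 y_{a-1}` on Taylor coefficients.
[cite: LaiLupuOrr2026, §3 eq. (2)] -/
theorem arcsinCoeff_rec (a n : ℕ) :
    arcsinCoeff a (n + 1) * ((2 * n + 2) * (2 * n + 1)) - 4 * (n : ℝ) ^ 2 * arcsinCoeff a n =
      4 * arcsinCoeffLower a n := by
  rcases Nat.eq_zero_or_pos n with rfl | hn
  · rw [arcsinCoeff_succ_mul]
    cases a with
    | zero => simp [arcsinCoeffLower_zero, Nat.centralBinom_zero]
    | succ a => simp [Nat.centralBinom_zero]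
  · rw [arcsinCoeff_succ_mul, four_mul_sq_mul_arcsinCoeff a hn.ne', ← sub_div, ← mul_sub]
    cases a with
    | zero => simp [arcsinCoeffLower_zero, hn.ne']
    | succ a =>
        rw [arcsinNestedSum_succ_succ a hn, arcsinCoeffLower_succ]
        unfold arcsinCoeff
        have hC : (n.centralBinom : ℝ) ≠ 0 := by exact_mod_cast Nat.centralBinom_ne_zero n
        have hn' : (n : ℝ) ≠ 0 := by exact_mod_cast hn.ne'
        field_simp
        ring

/-! ### The series `S_a(x) = ∑ c_a(n) x^{2n}` and its first two derivatives -/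

/-- `S_a(x) = ∑_{n} c_a(n) x^{2n}`. [cite: LaiLupuOrr2026, §3 eq. (6)] -/
def arcsinSeries (a : ℕ) (x : ℝ) : ℝ := ∑' n : ℕ, arcsinCoeff a n * x ^ (2 * n)

/-- `∑_{n} arcsinCoeffLower a n x^{2n}` (`= S_{a-1}(x)`, resp. `1` for `a = 0`). [folklore] -/
def arcsinLowerSeries (a : ℕ) (x : ℝ) : ℝ := ∑' n : ℕ, arcsinCoeffLower a n * x ^ (2 * n)

/-- A summable majorant: `n² rⁿ⁻¹` for `0 < r < 1`. [folklore] -/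
theorem summable_sq_mul_pow_pred {r : ℝ} (hr0 : 0 < r) (hr1 : r < 1) :
    Summable fun n : ℕ => (n : ℝ) ^ 2 * r ^ (n - 1) := by
  have h := (summable_pow_mul_geometric_of_norm_lt_one 2
    (show ‖r‖ < 1 by rwa [Real.norm_eq_abs, abs_of_pos hr0])).mul_left r⁻¹
  refine h.congr fun n => ?_
  rcases n with _ | n
  · simp
  · simp only [Nat.add_sub_cancel, pow_succ]; field_simp

/-- The uniform majorant used for `S_a`, `S_a'`, `S_a''` on `|y| ≤ r`. [folklore] -/
def arcsinMajorant (a : ℕ) (r : ℝ) (n : ℕ) : ℝ := 2 ^ (a + 1) * 4 * ((n : ℝ) ^ 2 * r ^ (n - 1))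

/-- The majorant is summable for `0 < r < 1`. [folklore] -/
theorem summable_arcsinMajorant (a : ℕ) {r : ℝ} (hr0 : 0 < r) (hr1 : r < 1) :
    Summable (arcsinMajorant a r) :=
  (summable_sq_mul_pow_pred hr0 hr1).mul_left _

/-- Terms of `S_a`: `|c_a(n) y^{2n}| ≤ majorant` for `|y| ≤ r < 1`. [folklore] -/
theorem abs_arcsinCoeff_mul_pow_le (a : ℕ) {r y : ℝ} (hr1 : r < 1) (hy : |y| ≤ r) (n : ℕ) :
    |arcsinCoeff a n * y ^ (2 * n)| ≤ arcsinMajorant a r n := by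
  have hr0 : 0 ≤ r := (abs_nonneg y).trans hy
  rcases Nat.eq_zero_or_pos n with rfl | hn
  · simp [arcsinMajorant]
  · rw [abs_mul, abs_pow, arcsinMajorant]
    have h1 : |y| ^ (2 * n) ≤ r ^ (n - 1) :=
      (pow_le_pow_left₀ (abs_nonneg y) hy _).trans
        (pow_le_pow_of_le_one hr0 hr1.le (by omega))
    have h2 : (1 : ℝ) ≤ (n : ℝ) ^ 2 := by
      have : (1 : ℝ) ≤ n := by exact_mod_cast hn
      nlinarith
    calc |arcsinCoeff a n| * |y| ^ (2 * n) ≤ 2 ^ (a + 1) * r ^ (n - 1) :=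
          mul_le_mul (abs_arcsinCoeff_le a n) h1 (by positivity) (by positivity)
      _ = 1 * (2 ^ (a + 1) * r ^ (n - 1)) := by ring
      _ ≤ (4 * (n : ℝ) ^ 2) * (2 ^ (a + 1) * r ^ (n - 1)) :=
          mul_le_mul_of_nonneg_right (by nlinarith) (by positivity)
      _ = 2 ^ (a + 1) * 4 * ((n : ℝ) ^ 2 * r ^ (n - 1)) := by ring

/-- Terms of `S_a'`: `|c_a(n) 2n y^{2n-1}| ≤ majorant` for `|y| ≤ r < 1`. [folklore] -/
theorem abs_arcsinCoeff_deriv_term_le (a : ℕ) {r y : ℝ} (hr1 : r < 1) (hy : |y| ≤ r) (n : ℕ) :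
    |arcsinCoeff a n * (2 * n) * y ^ (2 * n - 1)| ≤ arcsinMajorant a r n := by
  have hr0 : 0 ≤ r := (abs_nonneg y).trans hy
  rcases Nat.eq_zero_or_pos n with rfl | hn
  · simp [arcsinMajorant]
  · rw [abs_mul, abs_mul, abs_pow, arcsinMajorant, abs_of_nonneg (by positivity : (0 : ℝ) ≤ 2 * n)]
    have h1 : |y| ^ (2 * n - 1) ≤ r ^ (n - 1) :=
      (pow_le_pow_left₀ (abs_nonneg y) hy _).trans
        (pow_le_pow_of_le_one hr0 hr1.le (by omega))
    have hn' : (1 : ℝ) ≤ n := by exact_mod_cast hn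
    calc |arcsinCoeff a n| * (2 * n) * |y| ^ (2 * n - 1) ≤ 2 ^ (a + 1) * (2 * n) * r ^ (n - 1) :=
          mul_le_mul (mul_le_mul_of_nonneg_right (abs_arcsinCoeff_le a n) (by positivity)) h1
            (by positivity) (by positivity)
      _ = (2 * (n : ℝ)) * (2 ^ (a + 1) * r ^ (n - 1)) := by ring
      _ ≤ (4 * (n : ℝ) ^ 2) * (2 ^ (a + 1) * r ^ (n - 1)) :=
          mul_le_mul_of_nonneg_right (by nlinarith) (by positivity)
      _ = 2 ^ (a + 1) * 4 * ((n : ℝ) ^ 2 * r ^ (n - 1)) := by ring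

/-- Terms of `S_a''`: `|c_a(n) 2n (2n-1) y^{2n-2}| ≤ majorant` for `|y| ≤ r < 1`. [folklore] -/
theorem abs_arcsinCoeff_deriv2_term_le (a : ℕ) {r y : ℝ} (hr1 : r < 1) (hy : |y| ≤ r) (n : ℕ) :
    |arcsinCoeff a n * (2 * n) * ((2 * n - 1 : ℕ) : ℝ) * y ^ (2 * n - 2)| ≤
      arcsinMajorant a r n := by
  have hr0 : 0 ≤ r := (abs_nonneg y).trans hy
  rcases Nat.eq_zero_or_pos n with rfl | hn
  · simp [arcsinMajorant]
  · rw [abs_mul, abs_mul, abs_mul, abs_pow, arcsinMajorant,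
      abs_of_nonneg (by positivity : (0 : ℝ) ≤ 2 * n), Nat.abs_cast]
    have h1 : |y| ^ (2 * n - 2) ≤ r ^ (n - 1) :=
      (pow_le_pow_left₀ (abs_nonneg y) hy _).trans
        (pow_le_pow_of_le_one hr0 hr1.le (by omega))
    have hn' : (1 : ℝ) ≤ n := by exact_mod_cast hn
    have h3 : ((2 * n - 1 : ℕ) : ℝ) ≤ 2 * n := by
      have : (2 * n - 1 : ℕ) ≤ 2 * n := Nat.sub_le _ _
      exact_mod_cast this
    calc |arcsinCoeff a n| * (2 * n) * ((2 * n - 1 : ℕ) : ℝ) * |y| ^ (2 * n - 2)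
        ≤ 2 ^ (a + 1) * (2 * n) * (2 * n) * r ^ (n - 1) := by
          refine mul_le_mul ?_ h1 (by positivity) (by positivity)
          exact mul_le_mul (mul_le_mul_of_nonneg_right (abs_arcsinCoeff_le a n) (by positivity))
            h3 (by positivity) (by positivity)
      _ = 2 ^ (a + 1) * 4 * ((n : ℝ) ^ 2 * r ^ (n - 1)) := by ring

/-- A radius `r` with `|x| < r < 1`, `0 < r`. [folklore] -/
theorem exists_radius_of_abs_lt_one {x : ℝ} (hx : |x| < 1) : ∃ r : ℝ, |x| < r ∧ r < 1 ∧ 0 < r :=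
  ⟨(|x| + 1) / 2, by linarith, by linarith, by linarith [abs_nonneg x]⟩

/-- Summability of `∑ c_a(n) x^{2n}` for `|x| < 1`. [folklore] -/
theorem summable_arcsinCoeff_mul_pow (a : ℕ) {x : ℝ} (hx : |x| < 1) :
    Summable fun n : ℕ => arcsinCoeff a n * x ^ (2 * n) := by
  obtain ⟨r, hxr, hr1, hr0⟩ := exists_radius_of_abs_lt_one hx
  exact Summable.of_norm_bounded (summable_arcsinMajorant a hr0 hr1)
    fun n => by rw [Real.norm_eq_abs]; exact abs_arcsinCoeff_mul_pow_le a hr1 hxr.le n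

/-- Summability of `∑ c_a(n) 2n x^{2n-1}` for `|x| < 1`. [folklore] -/
theorem summable_arcsinCoeff_deriv_term (a : ℕ) {x : ℝ} (hx : |x| < 1) :
    Summable fun n : ℕ => arcsinCoeff a n * (2 * n) * x ^ (2 * n - 1) := by
  obtain ⟨r, hxr, hr1, hr0⟩ := exists_radius_of_abs_lt_one hx
  exact Summable.of_norm_bounded (summable_arcsinMajorant a hr0 hr1)
    fun n => by rw [Real.norm_eq_abs]; exact abs_arcsinCoeff_deriv_term_le a hr1 hxr.le n

/-- Summability of `∑ c_a(n) 2n(2n-1) x^{2n-2}` for `|x| < 1`. [folklore] -/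
theorem summable_arcsinCoeff_deriv2_term (a : ℕ) {x : ℝ} (hx : |x| < 1) :
    Summable fun n : ℕ => arcsinCoeff a n * (2 * n) * ((2 * n - 1 : ℕ) : ℝ) * x ^ (2 * n - 2) := by
  obtain ⟨r, hxr, hr1, hr0⟩ := exists_radius_of_abs_lt_one hx
  exact Summable.of_norm_bounded (summable_arcsinMajorant a hr0 hr1)
    fun n => by rw [Real.norm_eq_abs]; exact abs_arcsinCoeff_deriv2_term_le a hr1 hxr.le n

/-- Summability of the lower series for `|x| < 1`. [folklore] -/
theorem summable_arcsinCoeffLower_mul_pow (a : ℕ) {x : ℝ} (hx : |x| < 1) :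
    Summable fun n : ℕ => arcsinCoeffLower a n * x ^ (2 * n) := by
  cases a with
  | zero =>
      refine summable_of_ne_finset_zero (s := {0}) fun n hn => ?_
      rw [Finset.mem_singleton] at hn
      simp [arcsinCoeffLower_zero, hn]
  | succ a => simpa only [arcsinCoeffLower_succ] using summable_arcsinCoeff_mul_pow a hx

/-- `S_a` is differentiable on `(-1,1)` with derivative `S_a'(x) = ∑ c_a(n) 2n x^{2n-1}` (termwise).
[folklore] -/
theorem hasDerivAt_arcsinSeries (a : ℕ) {x : ℝ} (hx : |x| < 1) :
    HasDerivAt (arcsinSeries a) (∑' n : ℕ, arcsinCoeff a n * (2 * n) * x ^ (2 * n - 1)) x := by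
  obtain ⟨r, hxr, hr1, hr0⟩ := exists_radius_of_abs_lt_one hx
  have hxt : x ∈ Set.Ioo (-r) r := by rw [Set.mem_Ioo]; exact abs_lt.1 hxr
  refine hasDerivAt_tsum_of_isPreconnected (summable_arcsinMajorant a hr0 hr1) isOpen_Ioo
    (isPreconnected_Ioo) (g := fun n y => arcsinCoeff a n * y ^ (2 * n))
    (g' := fun n y => arcsinCoeff a n * (2 * n) * y ^ (2 * n - 1)) (fun n y _ => ?_)
    (fun n y hy => ?_) (show (0 : ℝ) ∈ Set.Ioo (-r) r by simp [hr0]) ?_ hxt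
  · have h := (hasDerivAt_pow (2 * n) y).const_mul (arcsinCoeff a n)
    simpa [mul_assoc] using h
  · rw [Real.norm_eq_abs]
    refine abs_arcsinCoeff_deriv_term_le a hr1 ?_ n
    rw [Set.mem_Ioo] at hy
    exact (abs_lt.2 hy).le
  · exact summable_arcsinCoeff_mul_pow a (by simp)

/-- `S_a'` is differentiable on `(-1,1)` with derivative `S_a''(x) = ∑ c_a(n) 2n(2n-1) x^{2n-2}`.
[folklore] -/
theorem hasDerivAt_arcsinSeries_deriv (a : ℕ) {x : ℝ} (hx : |x| < 1) :
    HasDerivAt (fun y => ∑' n : ℕ, arcsinCoeff a n * (2 * n) * y ^ (2 * n - 1))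
      (∑' n : ℕ, arcsinCoeff a n * (2 * n) * ((2 * n - 1 : ℕ) : ℝ) * x ^ (2 * n - 2)) x := by
  obtain ⟨r, hxr, hr1, hr0⟩ := exists_radius_of_abs_lt_one hx
  have hxt : x ∈ Set.Ioo (-r) r := by rw [Set.mem_Ioo]; exact abs_lt.1 hxr
  refine hasDerivAt_tsum_of_isPreconnected (summable_arcsinMajorant a hr0 hr1) isOpen_Ioo
    (isPreconnected_Ioo) (g := fun n y => arcsinCoeff a n * (2 * n) * y ^ (2 * n - 1))
    (g' := fun n y => arcsinCoeff a n * (2 * n) * ((2 * n - 1 : ℕ) : ℝ) * y ^ (2 * n - 2))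
    (fun n y _ => ?_) (fun n y hy => ?_) (show (0 : ℝ) ∈ Set.Ioo (-r) r by simp [hr0]) ?_ hxt
  · have h := (hasDerivAt_pow (2 * n - 1) y).const_mul (arcsinCoeff a n * (2 * n))
    have e : 2 * n - 1 - 1 = 2 * n - 2 := by omega
    rw [e] at h
    simpa [mul_assoc] using h
  · rw [Real.norm_eq_abs]
    refine abs_arcsinCoeff_deriv2_term_le a hr1 ?_ n
    rw [Set.mem_Ioo] at hy
    exact (abs_lt.2 hy).le
  · exact summable_arcsinCoeff_deriv_term a (by simp)

/-- The termwise form of the ODE: for every `n`,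
`c(n+1)(2n+2)(2n+1)x^{2n} − x²·c(n)2n(2n−1)x^{2n−2} − x·c(n)2n x^{2n−1} = 4·lower(n) x^{2n}`.
[folklore] -/
theorem arcsinCoeff_ode_termwise (a n : ℕ) (x : ℝ) :
    arcsinCoeff a (n + 1) * (2 * (n + 1 : ℕ)) * ((2 * (n + 1) - 1 : ℕ) : ℝ) * x ^ (2 * (n + 1) - 2)
      - x ^ 2 * (arcsinCoeff a n * (2 * n) * ((2 * n - 1 : ℕ) : ℝ) * x ^ (2 * n - 2))
      - x * (arcsinCoeff a n * (2 * n) * x ^ (2 * n - 1)) =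
      4 * arcsinCoeffLower a n * x ^ (2 * n) := by
  rw [← arcsinCoeff_rec a n]
  rcases n with _ | n
  · simp
  · have e1 : 2 * (n + 1 + 1) - 1 = 2 * n + 3 := by omega
    have e2 : 2 * (n + 1 + 1) - 2 = 2 * (n + 1) := by omega
    have e3 : 2 * (n + 1) - 1 = 2 * n + 1 := by omega
    have e4 : 2 * (n + 1) - 2 = 2 * n := by omega
    rw [e1, e2, e3, e4]
    have p1 : x ^ 2 * x ^ (2 * n) = x ^ (2 * (n + 1)) := by rw [← pow_add]; ring_nf
    have p2 : x * x ^ (2 * n + 1) = x ^ (2 * (n + 1)) := by rw [← pow_succ']; ring_nf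
    push_cast
    calc _ = arcsinCoeff a (n + 1 + 1) * (2 * (n + 1 + 1 : ℝ)) * (2 * n + 3) * x ^ (2 * (n + 1))
          - arcsinCoeff a (n + 1) * (2 * (n + 1 : ℝ)) * (2 * n + 1) * (x ^ 2 * x ^ (2 * n))
          - arcsinCoeff a (n + 1) * (2 * (n + 1 : ℝ)) * (x * x ^ (2 * n + 1)) := by ring
      _ = _ := by rw [p1, p2]; ring

/-- **The ODE for the series**: `(1 - x²) S_a''(x) - x S_a'(x) = 4 · (lower series)` for `|x| < 1`.
[cite: LaiLupuOrr2026, §3 eq. (2)] -/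
theorem arcsinSeries_ode (a : ℕ) {x : ℝ} (hx : |x| < 1) :
    (1 - x ^ 2) * (∑' n : ℕ, arcsinCoeff a n * (2 * n) * ((2 * n - 1 : ℕ) : ℝ) * x ^ (2 * n - 2))
      - x * (∑' n : ℕ, arcsinCoeff a n * (2 * n) * x ^ (2 * n - 1)) =
      4 * arcsinLowerSeries a x := by
  have h1 := (summable_arcsinCoeff_deriv_term a hx).hasSum
  have h2 := (summable_arcsinCoeff_deriv2_term a hx).hasSum
  have hL := (summable_arcsinCoeffLower_mul_pow a hx).hasSum
  have h2' := (hasSum_nat_add_iff' 1).mpr h2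
  simp only [Finset.range_one, Finset.sum_singleton, Nat.cast_zero, mul_zero, zero_mul,
    sub_zero] at h2'
  have hcomb := (h2'.sub (h2.mul_left (x ^ 2))).sub (h1.mul_left x)
  have hfun : (fun n : ℕ =>
      arcsinCoeff a (n + 1) * (2 * ((n + 1 : ℕ) : ℝ)) * ((2 * (n + 1) - 1 : ℕ) : ℝ) *
          x ^ (2 * (n + 1) - 2)
        - x ^ 2 * (arcsinCoeff a n * (2 * n) * ((2 * n - 1 : ℕ) : ℝ) * x ^ (2 * n - 2))
        - x * (arcsinCoeff a n * (2 * n) * x ^ (2 * n - 1))) =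
      fun n => 4 * (arcsinCoeffLower a n * x ^ (2 * n)) := by
    funext n
    have := arcsinCoeff_ode_termwise a n x
    push_cast at this ⊢
    linear_combination this
  rw [hfun] at hcomb
  have h4 := hL.mul_left 4
  have := hcomb.unique h4
  unfold arcsinLowerSeries
  linear_combination this

/-! ### The functions `y_k = (2 arcsin x)^{2k}/(2k)!` and their ODE -/

/-- `y_k(x) = (2 arcsin x)^{2k} / (2k)!`. [cite: LaiLupuOrr2026, §3 eq. (6)] -/
def arcsinPowG (k : ℕ) (x : ℝ) : ℝ := (2 * arcsin x) ^ (2 * k) / (2 * k)!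

/-- `y_{k+1}'(x) = 2 (2 arcsin x)^{2k+1} / ((2k+1)! √(1-x²))`. [folklore] -/
def arcsinPowG1 (k : ℕ) (x : ℝ) : ℝ :=
  2 * (2 * arcsin x) ^ (2 * k + 1) / ((2 * k + 1)! * √(1 - x ^ 2))

/-- `y_{k+1}''(x) = 4 (2 arcsin x)^{2k} / ((2k)! (1-x²)) + x y_{k+1}'(x) / (1-x²)`. [folklore] -/
def arcsinPowG2 (k : ℕ) (x : ℝ) : ℝ :=
  4 * (2 * arcsin x) ^ (2 * k) / ((2 * k)! * (1 - x ^ 2)) + x * arcsinPowG1 k x / (1 - x ^ 2)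

/-- `1 - x² > 0` for `|x| < 1`. [folklore] -/
theorem one_sub_sq_pos_of_abs_lt_one {x : ℝ} (hx : |x| < 1) : 0 < 1 - x ^ 2 := by
  have := abs_lt.1 hx; nlinarith

/-- `y_{k+1}' = arcsinPowG1 k` on `(-1,1)`. [folklore] -/
theorem hasDerivAt_arcsinPowG (k : ℕ) {x : ℝ} (hx : |x| < 1) :
    HasDerivAt (arcsinPowG (k + 1)) (arcsinPowG1 k x) x := by
  have hx' := abs_lt.1 hx
  have hA := Real.hasDerivAt_arcsin (x := x) (by linarith) (by linarith)
  have hs : 0 < √(1 - x ^ 2) := Real.sqrt_pos.2 (one_sub_sq_pos_of_abs_lt_one hx)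
  have h := ((hA.const_mul 2).pow (2 * k + 2)).div_const ((2 * k + 2)! : ℝ)
  have e : arcsinPowG (k + 1) = fun y => (2 * arcsin y) ^ (2 * k + 2) / ((2 * k + 2)! : ℝ) := by
    funext y; simp [arcsinPowG, mul_add]
  rw [e]
  refine h.congr_deriv ?_
  have e1 : 2 * k + 2 - 1 = 2 * k + 1 := by omega
  have e2 : ((2 * k + 2)! : ℝ) = (2 * k + 2) * (2 * k + 1)! := by
    rw [show 2 * k + 2 = (2 * k + 1) + 1 by ring, Nat.factorial_succ]; push_cast; ring
  rw [e1, e2]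
  unfold arcsinPowG1
  push_cast
  have hf : ((2 * k + 1)! : ℝ) ≠ 0 := by positivity
  field_simp

/-- `(arcsinPowG1 k)' = arcsinPowG2 k` on `(-1,1)`. [folklore] -/
theorem hasDerivAt_arcsinPowG1 (k : ℕ) {x : ℝ} (hx : |x| < 1) :
    HasDerivAt (arcsinPowG1 k) (arcsinPowG2 k x) x := by
  have hx' := abs_lt.1 hx
  have h1x := one_sub_sq_pos_of_abs_lt_one hx
  have hA := Real.hasDerivAt_arcsin (x := x) (by linarith) (by linarith)
  set s := √(1 - x ^ 2) with hs_def
  have hs : 0 < s := Real.sqrt_pos.2 h1x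
  have hs2 : s ^ 2 = 1 - x ^ 2 := Real.sq_sqrt h1x.le
  -- numerator and denominator
  have hN : HasDerivAt (fun y => 2 * (2 * arcsin y) ^ (2 * k + 1))
      (2 * ((2 * k + 1 : ℕ) * (2 * arcsin x) ^ (2 * k) * (2 * (1 / s)))) x := by
    have := ((hA.const_mul 2).pow (2 * k + 1)).const_mul 2
    simpa using this
  have hD0 : HasDerivAt (fun y : ℝ => 1 - y ^ 2) (-(2 * x)) x := by
    simpa using (hasDerivAt_pow 2 x).const_sub 1
  have hD : HasDerivAt (fun y => ((2 * k + 1)! : ℝ) * √(1 - y ^ 2))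
      (((2 * k + 1)! : ℝ) * (-(2 * x) / (2 * s))) x :=
    (hD0.sqrt h1x.ne').const_mul _
  have hDne : ((2 * k + 1)! : ℝ) * s ≠ 0 := by positivity
  have h := hN.div hD hDne
  have e : arcsinPowG1 k = fun y =>
      (2 * (2 * arcsin y) ^ (2 * k + 1)) / (((2 * k + 1)! : ℝ) * √(1 - y ^ 2)) := by
    funext y; simp [arcsinPowG1]
  rw [e]
  refine h.congr_deriv ?_
  unfold arcsinPowG2 arcsinPowG1
  rw [← hs_def, ← hs2]
  rw [Nat.factorial_succ]
  push_cast
  have hf : ((2 * k)! : ℝ) ≠ 0 := by positivity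
  have h2k1 : (2 * (k : ℝ) + 1) ≠ 0 := by positivity
  field_simp
  ring

/-- **The ODE for `arcsin` powers**: `(1 - x²) y_{k+1}'' - x y_{k+1}' = 4 y_k` on `(-1,1)`.
[cite: LaiLupuOrr2026, §3 eq. (2)] -/
theorem arcsinPowG_ode (k : ℕ) {x : ℝ} (hx : |x| < 1) :
    (1 - x ^ 2) * arcsinPowG2 k x - x * arcsinPowG1 k x = 4 * arcsinPowG k x := by
  have h1x := one_sub_sq_pos_of_abs_lt_one hx
  unfold arcsinPowG2 arcsinPowG
  have hf : ((2 * k)! : ℝ) ≠ 0 := by positivity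
  field_simp
  ring

/-! ### Uniqueness and the main theorem -/

/-- `S_a(0) = 0`. [folklore] -/
theorem arcsinSeries_zero (a : ℕ) : arcsinSeries a 0 = 0 := by
  unfold arcsinSeries
  rw [tsum_eq_single 0 fun n hn => by simp [hn]]
  simp

/-- `S_a'(0) = 0`. [folklore] -/
theorem arcsinSeries_deriv_zero (a : ℕ) :
    (∑' n : ℕ, arcsinCoeff a n * (2 * n) * (0 : ℝ) ^ (2 * n - 1)) = 0 := by
  have : (fun n : ℕ => arcsinCoeff a n * (2 * n) * (0 : ℝ) ^ (2 * n - 1)) = fun _ => 0 := by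
    funext n
    rcases n with _ | n
    · simp
    · have : 2 * (n + 1) - 1 ≠ 0 := by omega
      simp [this]
  rw [this, tsum_zero]

/-- The lower series for `a = 0` is the constant `1`. [folklore] -/
theorem arcsinLowerSeries_zero (x : ℝ) : arcsinLowerSeries 0 x = 1 := by
  unfold arcsinLowerSeries
  rw [tsum_eq_single 0 fun n hn => by simp [arcsinCoeffLower_zero, hn]]
  simp [arcsinCoeffLower_zero]

/-- The lower series for `a + 1` is `S_a`. [folklore] -/
theorem arcsinLowerSeries_succ (a : ℕ) (x : ℝ) : arcsinLowerSeries (a + 1) x = arcsinSeries a x := by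
  simp [arcsinLowerSeries, arcsinSeries]

/-- The induction step: if the lower series is `y_a` on `(-1,1)`, then `S_a = y_{a+1}` on `(-1,1)`
(uniqueness for `(1-x²)D'' - xD' = 0`, `D(0) = D'(0) = 0`, via `W = √(1-x²) D'`). [folklore] -/
theorem arcsinSeries_eq_of_lower (a : ℕ)
    (hlow : ∀ y : ℝ, |y| < 1 → arcsinLowerSeries a y = arcsinPowG a y) {x : ℝ} (hx : |x| < 1) :
    arcsinSeries a x = arcsinPowG (a + 1) x := by
  -- notation
  set S1 : ℝ → ℝ := fun y => ∑' n : ℕ, arcsinCoeff a n * (2 * n) * y ^ (2 * n - 1) with hS1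
  set S2 : ℝ → ℝ := fun y =>
    ∑' n : ℕ, arcsinCoeff a n * (2 * n) * ((2 * n - 1 : ℕ) : ℝ) * y ^ (2 * n - 2) with hS2
  have hU : IsOpen (Set.Ioo (-1 : ℝ) 1) := isOpen_Ioo
  have hUc : IsPreconnected (Set.Ioo (-1 : ℝ) 1) := isPreconnected_Ioo
  have memU : ∀ {y : ℝ}, y ∈ Set.Ioo (-1 : ℝ) 1 ↔ |y| < 1 := fun {y} => by
    rw [Set.mem_Ioo, abs_lt]
  -- the key identity (E): (1-y²)(S2 - G2) - y (S1 - G1) = 0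
  have hE : ∀ y : ℝ, |y| < 1 →
      (1 - y ^ 2) * (S2 y - arcsinPowG2 a y) - y * (S1 y - arcsinPowG1 a y) = 0 := by
    intro y hy
    have h1 := arcsinSeries_ode a hy
    have h2 := arcsinPowG_ode a hy
    have h3 := hlow y hy
    simp only [hS1, hS2]
    linear_combination h1 - h2 + 4 * h3
  -- W = √(1-y²) (S1 - G1) has zero derivative
  set W : ℝ → ℝ := fun y => √(1 - y ^ 2) * (S1 y - arcsinPowG1 a y) with hW
  have hWd : ∀ y : ℝ, |y| < 1 → HasDerivAt W 0 y := by
    intro y hy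
    have h1y := one_sub_sq_pos_of_abs_lt_one hy
    have hsq : HasDerivAt (fun z : ℝ => √(1 - z ^ 2)) (-(2 * y) / (2 * √(1 - y ^ 2))) y := by
      have hD0 : HasDerivAt (fun z : ℝ => 1 - z ^ 2) (-(2 * y)) y := by
        simpa using (hasDerivAt_pow 2 y).const_sub 1
      exact hD0.sqrt h1y.ne'
    have hg : HasDerivAt (fun z => S1 z - arcsinPowG1 a z) (S2 y - arcsinPowG2 a y) y :=
      (hasDerivAt_arcsinSeries_deriv a hy).sub (hasDerivAt_arcsinPowG1 a hy)
    have h := hsq.mul hg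
    refine h.congr_deriv ?_
    set s := √(1 - y ^ 2) with hs_def
    have hs : 0 < s := Real.sqrt_pos.2 h1y
    have hs2 : s ^ 2 = 1 - y ^ 2 := Real.sq_sqrt h1y.le
    have hE' := hE y hy
    rw [← hs2] at hE'
    field_simp
    linear_combination hE'
  have hWdiff : DifferentiableOn ℝ W (Set.Ioo (-1 : ℝ) 1) := fun y hy =>
    (hWd y (memU.1 hy)).differentiableAt.differentiableWithinAt
  have hW0 : W 0 = 0 := by
    simp only [hW, hS1]
    rw [arcsinSeries_deriv_zero]
    simp [arcsinPowG1]
  have hWc : ∀ y : ℝ, |y| < 1 → W y = 0 := by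
    intro y hy
    rw [← hW0]
    exact hU.is_const_of_deriv_eq_zero hUc hWdiff (fun z hz => (hWd z (memU.1 hz)).deriv)
      (memU.2 hy) (memU.2 (by simp))
  -- hence S1 = G1 on (-1,1)
  have hS1G1 : ∀ y : ℝ, |y| < 1 → S1 y = arcsinPowG1 a y := by
    intro y hy
    have h := hWc y hy
    have hs : 0 < √(1 - y ^ 2) := Real.sqrt_pos.2 (one_sub_sq_pos_of_abs_lt_one hy)
    simp only [hW] at h
    rcases mul_eq_zero.1 h with h | h
    · exact absurd h hs.ne'
    · linarith
  -- D = S - G has zero derivative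
  set D : ℝ → ℝ := fun y => arcsinSeries a y - arcsinPowG (a + 1) y with hD
  have hDd : ∀ y : ℝ, |y| < 1 → HasDerivAt D 0 y := by
    intro y hy
    have h := (hasDerivAt_arcsinSeries a hy).sub (hasDerivAt_arcsinPowG a hy)
    refine h.congr_deriv ?_
    have := hS1G1 y hy
    simp only [hS1] at this
    rw [this, sub_self]
  have hDdiff : DifferentiableOn ℝ D (Set.Ioo (-1 : ℝ) 1) := fun y hy =>
    (hDd y (memU.1 hy)).differentiableAt.differentiableWithinAt
  have hD0 : D 0 = 0 := by
    simp only [hD]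
    rw [arcsinSeries_zero]
    simp [arcsinPowG]
  have hDx : D x = D 0 :=
    hU.is_const_of_deriv_eq_zero hUc hDdiff (fun z hz => (hDd z (memU.1 hz)).deriv)
      (memU.2 hx) (memU.2 (by simp))
  rw [hD0] at hDx
  simp only [hD] at hDx
  linarith

/-- `S_a = y_{a+1}` on `(-1,1)`, by induction on `a`. [cite: LaiLupuOrr2026, §3 eq. (6)] -/
theorem arcsinSeries_eq_arcsinPowG : ∀ (a : ℕ) {x : ℝ}, |x| < 1 →
    arcsinSeries a x = arcsinPowG (a + 1) x
  | 0, x, hx => arcsinSeries_eq_of_lower 0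
      (fun y _ => by rw [arcsinLowerSeries_zero]; simp [arcsinPowG]) hx
  | a + 1, x, hx => arcsinSeries_eq_of_lower (a + 1)
      (fun y hy => by rw [arcsinLowerSeries_succ]; exact arcsinSeries_eq_arcsinPowG a hy) hx

/-- **The power series of the even powers of `arcsin`** (Borwein–Chamberland 2007; Lai–Lupu–Orr,
eq. (2)/(6)): for `|x| < 1` and every `a ≥ 0`,
`∑_{n ≥ 1} 4ⁿ e_a(n) / (n² binom(2n,n)) · x^{2n} = (2 arcsin x)^{2a+2} / (2a+2)!`, where
`e_a(n) = ∑_{n > n₁ > ⋯ > n_a ≥ 1} (n₁⋯n_a)^{-2}`. [cite: LaiLupuOrr2026, §3 eq. (6)] -/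
theorem hasSum_arcsinCoeff (a : ℕ) {x : ℝ} (hx : |x| < 1) :
    HasSum (fun n : ℕ => arcsinCoeff a n * x ^ (2 * n))
      ((2 * arcsin x) ^ (2 * a + 2) / (2 * a + 2)!) := by
  have h := (summable_arcsinCoeff_mul_pow a hx).hasSum
  have e := arcsinSeries_eq_arcsinPowG a hx
  unfold arcsinSeries at e
  rw [e, arcsinPowG, show 2 * (a + 1) = 2 * a + 2 by ring] at h
  exact h

/-- Euler's case `a = 0`: `∑_{n ≥ 1} 4ⁿ x^{2n} / (n² binom(2n,n)) = 2 arcsin² x` for `|x| < 1`.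
[cite: LaiLupuOrr2026, §3 eq. (2)] -/
theorem hasSum_arcsin_sq {x : ℝ} (hx : |x| < 1) :
    HasSum (fun n : ℕ => (4 : ℝ) ^ n / ((n : ℝ) ^ 2 * n.centralBinom) * x ^ (2 * n))
      (2 * arcsin x ^ 2) := by
  have h := hasSum_arcsinCoeff 0 hx
  simp only [arcsinCoeff, arcsinNestedSum_zero, mul_one] at h
  convert h using 1
  simp [Nat.factorial]
  ring

end Literature.Analysis.SpecialFunctions
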